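import Summits.CriticalPhenomena.PercolationContinuityZ3.Theorems.PercNearOneGluingNoHeavyRsw3VolumeSecondMoment
import HarnessLib

/-!
# RSW3 lane (P2, gen 19): the VOLUME of the critical cluster, III — FAT CLUSTERS AT THE IIC SCALE and the volume upper tail
# (every `p` satisfying the ratio inequalities and the two-point lower bound `τ_p(0,x) ≥ c π_p(n)²` on `Λ(n)`)

builds on p205010 (kernel theorem, internal audit signed; external expert review pending) — NOT used in this file.

Cell `prim-rsw3`, prover seat `prim-rsw3-p2` (gen 19), memo `run/shared/lean/prim/rsw3/P2-RSWLITE.md` §26.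
Support file (`--supports stmt-CriticalPhenomena-4575`); no definitions, no named facts, no sorries.

EVERY-`p` CORE, part III.  `D_n(ω) = #{z ∈ Λ(n) : 0 ↔ z} = |C(0) ∩ Λ(n)|` (p1's inline count, `…IICPlanarDensityMarkov`).

* `exists_le_real_card_ge_of_ratio` (general family `F n x ⊆ {0 ↔ x}`, e.g. `{0 ↔ x in Λ(4n)}`) and `exists_le_real_volume_ge_of_ratio`
  (`F n x = {0 ↔ x}`) — under (R1), (R2), `π_p(1) > 0` and `cL·π_p(n)² ≤ P_p(F n x)` (`x ∈ Λ(n) ∖ 0`, `‖x‖ ≥ n₀`):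
  `∃ λ, c > 0, ∀ n ≥ 1, c·π_p(n) ≤ P_p( λ(2n+1)^d π_p(n) ≤ D_n ∧ 0 ↔ ∂ⁱⁿΛ(⌊n/2⌋) )` — second-moment method on the shell
  `Λ(n) ∖ Λ(⌊n/2⌋)` (first moment `≥ (cL/3)(2n+1)^dπ²`, second moment `≤ C₃(2n+1)^{2d}π³`, the count lives on the arm event of
  probability `≤ Bπ(n)`, thresholded Paley–Zygmund at the level `(cL/6B)(2n+1)^dπ(n)`);
* `real_volume_ge_le_of_ratio` — under (R1) and `p > 0`: `P_p( λ(2n+1)^dπ_p(n) ≤ D_R ) ≤ (1 + C₂/λ)·π_p(n)` for every `R`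
  (arm to `∂ⁱⁿΛ(n)`, or the cluster sits in `Λ(n)` and Markov with `E D_n ≤ C₂ n^d π²` applies).
At `p_c(ℤ^d)` under (A2)□ all hypotheses hold: `…Rsw3VolumeHyperscaling.lean`.

References: C. Borgs, J. Chayes, H. Kesten, J. Spencer, *Uniform boundedness of critical crossing probabilities implies hyperscaling*,
Random Structures Algorithms 15 (1999) 368–413 (hyperscaling relations `dρ = δ + 1`, `2 − η = d(δ−1)/(δ+1)` under box-crossing
postulates) [BorgsChayesKestenSpencer1999]; H. Kesten, PTRF 73 (1986), Thm. (8) (volume of the planar IIC) [Kesten1986]; H. Kesten,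
Comm. Math. Phys. 109 (1987) (scaling relations) [Kesten1987]; D. Basu, A. Sapozhnikov, ECP 22 (2017), §1 (A2) [BasuSapozhnikov2017ECP];
R. Lyons, Y. Peres, *Probability on Trees and Networks* (2016), §5.5 (Paley–Zygmund) [LyonsPeres2016]; G. Grimmett, *Percolation*
(1999), §2.2 (disjoint-support independence) [GrimmettPercolation1999]. [folklore]
-/

noncomputable section

namespace Summit.CriticalPhenomena.PercolationContinuityZ3.Theorems

namespace Rsw3

open MeasureTheory Literature.Probability.LatticeModels Literature.Probability.Percolation
open SurfaceTension Crossing SimpleGraph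

variable {d : ℕ}

/-! ## Fat clusters at the IIC scale (every `p` satisfying (R1), (R2) and the two-point lower bound) -/

/-- The shell `Λ(n) ∖ Λ(⌊n/2⌋)` carries a third of the volume: `(2n+1)^d ≤ 3 · |Λ(n) ∖ Λ(⌊n/2⌋)|` (`n ≥ 1`, `d ≥ 1`). [folklore] -/
theorem pow_le_three_mul_card_shell (hd : 1 ≤ d) {n : ℕ} (hn : 1 ≤ n) :
    (2 * (n : ℝ) + 1) ^ d ≤ 3 * ((box d n \ box d (n / 2)).card : ℝ) := by
  have hsub : box d (n / 2) ⊆ box d n := box_mono d (Nat.div_le_self n 2)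
  have hcard : ((box d n \ box d (n / 2)).card : ℝ) = (2 * (n : ℝ) + 1) ^ d - (2 * ((n / 2 : ℕ) : ℝ) + 1) ^ d := by
    rw [Finset.card_sdiff_of_subset hsub, card_box, card_box]
    have hle : (2 * (n / 2) + 1) ^ d ≤ (2 * n + 1) ^ d := Nat.pow_le_pow_left (by omega) d
    push_cast [Nat.cast_sub hle]
    ring
  rw [hcard]
  -- `(2⌊n/2⌋+1)^d ≤ (n+1)^d ≤ (2/3)(2n+1)^d`
  have hn1 : (1 : ℝ) ≤ n := by exact_mod_cast hn
  have hm : (2 * ((n / 2 : ℕ) : ℝ) + 1) ≤ (n : ℝ) + 1 := by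
    have : 2 * (n / 2) ≤ n := Nat.mul_div_le n 2
    exact_mod_cast (by omega : 2 * (n / 2) + 1 ≤ n + 1)
  have h1 : (2 * ((n / 2 : ℕ) : ℝ) + 1) ^ d ≤ ((n : ℝ) + 1) ^ d := pow_le_pow_left₀ (by positivity) hm d
  have h2 : 3 * ((n : ℝ) + 1) ^ d ≤ 2 * (2 * (n : ℝ) + 1) ^ d := by
    obtain ⟨e, he⟩ : ∃ e, d = e + 1 := ⟨d - 1, by omega⟩
    subst he
    rw [pow_succ, pow_succ]
    have h3 : ((n : ℝ) + 1) ^ e ≤ (2 * (n : ℝ) + 1) ^ e := pow_le_pow_left₀ (by positivity) (by linarith) e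
    have h4 : 0 ≤ (2 * (n : ℝ) + 1) ^ e := by positivity
    nlinarith
  linarith

open Classical in
/-- If `ω ∈ F 0` always, the count `#{z ∈ Λ(n) : F z}` is at least one. [folklore] -/
theorem one_le_card_filter_of_mem_zero {F : Site d → Set (BondConfig (Site d))} (hF0 : ∀ ω, ω ∈ F 0) (n : ℕ)
    (ω : BondConfig (Site d)) : (1 : ℝ) ≤ ((((box d n).filter fun z => ω ∈ F z).card : ℕ) : ℝ) := by
  have h0 : (0 : Site d) ∈ (box d n).filter fun z => ω ∈ F z := Finset.mem_filter.2 ⟨zero_mem_box d n, hF0 ω⟩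
  exact_mod_cast Finset.card_pos.2 ⟨0, h0⟩

open Classical in
/-- **FAT CLUSTERS AT THE IIC SCALE — general form** (every `p`, `d ≥ 1`).  Let `F n x ⊆ {0 ↔ x}` be measurable events with
`ω ∈ F n 0` always (think `F n x = {0 ↔ x}` or `{0 ↔ x in Λ(4n)}`), and assume the ratio inequalities (R1), (R2), `π_p(1) > 0`, and the
two-point lower bound `cL · π_p(n)² ≤ P_p(F n x)` for `x ∈ Λ(n) ∖ {0}` with `‖x‖ ≥ n₀`.  Then there are `λ, c > 0` with, for every `n ≥ 1`,
`c · π_p(n) ≤ P_p( λ·(2n+1)^d·π_p(n) ≤ #{z ∈ Λ(n) : F n z}  and  0 ↔ ∂ⁱⁿΛ(⌊n/2⌋) )`.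
PROOF: second-moment method for `N = #{x ∈ Λ(n) ∖ Λ(⌊n/2⌋) : F n x}` — `E N ≥ (cL/3)(2n+1)^d π(n)²`, `E N² ≤ C₃ (2n+1)^{2d} π(n)³`
(`sum_sum_real_openConn_inter_le_of_ratio`, as `F n x ⊆ {0 ↔ x}`), `{N > 0} ⊆ {0 ↔ ∂ⁱⁿΛ(⌊n/2⌋)}` of probability `≤ B π(n)`, and the
thresholded Paley–Zygmund lemma at the level `t = (cL/6B)(2n+1)^d π(n)`.
[cite: BorgsChayesKestenSpencer1999, §1 (hyperscaling relations)] [cite: Kesten1986, Thm. (8)] -/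
theorem exists_le_real_card_ge_of_ratio (hd : 1 ≤ d) (p : unitInterval) {A B cL : ℝ} (hA : 0 ≤ A) (hB : 0 < B)
    (hcL : 0 < cL)
    (hR1 : ∀ j n : ℕ, 1 ≤ j → j ≤ n →
      oneArmProb d p j ^ 2 * ((j : ℝ) / (16 * n)) ^ (d - 1) ≤ A * oneArmProb d p n ^ 2)
    (hR2 : ∀ j n : ℕ, 1 ≤ j → j ≤ n → n ≤ 8 * j → oneArmProb d p j ≤ B * oneArmProb d p n)
    (hπ1 : 0 < oneArmProb d p 1)
    (F : ℕ → Site d → Set (BondConfig (Site d))) (hFsub : ∀ n x, F n x ⊆ openConn 0 x)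
    (hFm : ∀ n x, MeasurableSet (F n x)) (hF0 : ∀ n ω, ω ∈ F n 0) {n₀ : ℕ}
    (hL : ∀ (n : ℕ) (x : Site d), x ∈ box d n → n₀ ≤ Site.supNorm x → x ≠ 0 →
      cL * oneArmProb d p n ^ 2 ≤ (bondPercolation (zdGraph d) p).real (F n x)) :
    ∃ lam c : ℝ, 0 < lam ∧ 0 < c ∧ ∀ n : ℕ, 1 ≤ n →
      c * oneArmProb d p n ≤ (bondPercolation (zdGraph d) p).real
        ({ω | lam * ((2 * (n : ℝ) + 1) ^ d * oneArmProb d p n) ≤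
            ((((box d n).filter fun z => ω ∈ F n z).card : ℕ) : ℝ)} ∩ siteToBoundary d (n / 2)) := by
  classical
  set μ := bondPercolation (zdGraph d) p with hμ
  set C₂ : ℝ := 2 * d * A * (192 : ℝ) ^ (d - 1) + (5 : ℝ) ^ d * (A * (16 : ℝ) ^ (d - 1) / oneArmProb d p 1 ^ 2) with hC₂
  set C₃ : ℝ := B ^ 3 * (C₂ + (5 : ℝ) ^ d) with hC₃
  have hd0 : (0 : ℝ) < d := by exact_mod_cast (by omega : 0 < d)
  have hC₂0 : 0 ≤ C₂ :=
    add_nonneg (by positivity) (mul_nonneg (by positivity) (div_nonneg (by positivity) (sq_nonneg _)))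
  have hC₃pos : 0 < C₃ := mul_pos (pow_pos hB 3) (add_pos_of_nonneg_of_pos hC₂0 (by positivity))
  -- small scales are handled trivially below `N₁ = max 4 (2 n₀)`
  set N₁ : ℕ := max 4 (2 * n₀) with hN₁
  have hV₁ : (0 : ℝ) < (2 * (N₁ : ℝ) + 1) ^ d := by positivity
  refine ⟨min (cL / (6 * B)) ((2 * (N₁ : ℝ) + 1) ^ d)⁻¹, min (cL ^ 2 / (36 * C₃)) 1, lt_min (by positivity) (by positivity),
    lt_min (by positivity) one_pos, fun n hn => ?_⟩
  have hπn0 : 0 ≤ oneArmProb d p n := measureReal_nonneg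
  have hπn1 : oneArmProb d p n ≤ 1 := measureReal_le_one
  by_cases hn4 : n < N₁
  · -- small `n`: the level is `≤ 1 ≤` the count, so the event is the arm event, of probability `π(⌊n/2⌋) ≥ π(n)`
    have hlev : min (cL / (6 * B)) ((2 * (N₁ : ℝ) + 1) ^ d)⁻¹ * ((2 * (n : ℝ) + 1) ^ d * oneArmProb d p n) ≤ 1 := by
      have h7 : (2 * (n : ℝ) + 1) ^ d ≤ (2 * (N₁ : ℝ) + 1) ^ d :=
        pow_le_pow_left₀ (by positivity) (by have : (n : ℝ) ≤ N₁ := (by exact_mod_cast hn4.le); linarith) d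
      calc min (cL / (6 * B)) ((2 * (N₁ : ℝ) + 1) ^ d)⁻¹ * ((2 * (n : ℝ) + 1) ^ d * oneArmProb d p n)
          ≤ ((2 * (N₁ : ℝ) + 1) ^ d)⁻¹ * ((2 * (N₁ : ℝ) + 1) ^ d * 1) :=
            mul_le_mul (min_le_right _ _) (mul_le_mul h7 hπn1 hπn0 (by positivity)) (mul_nonneg (by positivity) hπn0)
              (by positivity)
        _ = 1 := by rw [mul_one, inv_mul_cancel₀ hV₁.ne']
    have hsub : siteToBoundary d (n / 2) ⊆
        {ω | min (cL / (6 * B)) ((2 * (N₁ : ℝ) + 1) ^ d)⁻¹ * ((2 * (n : ℝ) + 1) ^ d * oneArmProb d p n) ≤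
            ((((box d n).filter fun z => ω ∈ F n z).card : ℕ) : ℝ)} ∩ siteToBoundary d (n / 2) :=
      fun ω hω => ⟨hlev.trans (one_le_card_filter_of_mem_zero (hF0 n) n ω), hω⟩
    calc min (cL ^ 2 / (36 * C₃)) 1 * oneArmProb d p n ≤ 1 * oneArmProb d p (n / 2) :=
          mul_le_mul (min_le_right _ _) (DCT16.real_siteToBoundary_antitone p (Nat.div_le_self n 2)) hπn0 zero_le_one
      _ = μ.real (siteToBoundary d (n / 2)) := by rw [one_mul]; rfl
      _ ≤ _ := measureReal_mono hsub (measure_ne_top _ _)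
  · -- `n ≥ N₁ ≥ 4`: second-moment method on the shell
    push Not at hn4
    have hn4' : 4 ≤ n := le_trans (le_max_left _ _) hn4
    have hn₀ : 2 * n₀ ≤ n := le_trans (le_max_right _ _) hn4
    set m : ℕ := n / 2 with hm
    set S : Finset (Site d) := box d n \ box d m with hS
    have hm1 : 1 ≤ m := by omega
    have hmn : m ≤ n := by omega
    have hn8m : n ≤ 8 * m := by omega
    have hn0 : (0 : ℝ) < n := by exact_mod_cast (by omega : 0 < n)
    -- first moment
    have hmem : ∀ x ∈ S, x ∈ box d n ∧ n₀ ≤ Site.supNorm x ∧ x ≠ 0 := by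
      intro x hx
      rw [hS, Finset.mem_sdiff] at hx
      refine ⟨hx.1, ?_, fun h => hx.2 (by rw [h]; exact zero_mem_box d m)⟩
      have h := hx.2
      rw [mem_box_iff_supNorm_le, not_le] at h
      omega
    have hfirst : cL * oneArmProb d p n ^ 2 * (S.card : ℝ) ≤ ∑ x ∈ S, μ.real (F n x) := by
      calc cL * oneArmProb d p n ^ 2 * (S.card : ℝ) = ∑ _x ∈ S, cL * oneArmProb d p n ^ 2 := by
            rw [Finset.sum_const, nsmul_eq_mul]; ring
        _ ≤ ∑ x ∈ S, μ.real (F n x) := Finset.sum_le_sum fun x hx =>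
            hL n x (hmem x hx).1 (hmem x hx).2.1 (hmem x hx).2.2
    have hshell : (2 * (n : ℝ) + 1) ^ d ≤ 3 * (S.card : ℝ) := pow_le_three_mul_card_shell hd (by omega)
    -- the union is inside the arm event to `∂ⁱⁿΛ(m)`
    have hUsub : μ.real (⋃ x ∈ S, F n x) ≤ μ.real (siteToBoundary d m) := by
      refine DCT16.real_mono_of_forall_subset_edgeSet (zdGraph d) p fun ω hω h => ?_
      obtain ⟨x, hx, hωx⟩ := Set.mem_iUnion₂.1 h
      rw [hS, Finset.mem_sdiff] at hx
      rw [← DCT16.armEvent_zero]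
      exact DCT16.armEvent_of_pathIn hω (pathIn_univ_of_reachable_zd (hFsub n x hωx)) (Or.inl (by rw [sub_zero]; exact hx.2))
    have hU : μ.real (⋃ x ∈ S, F n x) ≤ B * oneArmProb d p n := hUsub.trans (hR2 m n hm1 hmn hn8m)
    -- the level
    set t : ℝ := cL / (6 * B) * ((2 * (n : ℝ) + 1) ^ d * oneArmProb d p n) with ht
    have ht0 : 0 ≤ t := mul_nonneg (div_nonneg hcL.le (by positivity)) (mul_nonneg (by positivity) hπn0)
    have htU : t * μ.real (⋃ x ∈ S, F n x) ≤ cL / 6 * (2 * (n : ℝ) + 1) ^ d * oneArmProb d p n ^ 2 := by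
      calc t * μ.real (⋃ x ∈ S, F n x) ≤ t * (B * oneArmProb d p n) := mul_le_mul_of_nonneg_left hU ht0
        _ = cL / 6 * (2 * (n : ℝ) + 1) ^ d * oneArmProb d p n ^ 2 := by rw [ht]; field_simp
    have hgap : cL / 6 * (2 * (n : ℝ) + 1) ^ d * oneArmProb d p n ^ 2 ≤
        ∑ x ∈ S, μ.real (F n x) - t * μ.real (⋃ x ∈ S, F n x) := by
      have : cL / 3 * (2 * (n : ℝ) + 1) ^ d * oneArmProb d p n ^ 2 ≤ cL * oneArmProb d p n ^ 2 * (S.card : ℝ) := by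
        have h := mul_le_mul_of_nonneg_left hshell (mul_nonneg (by positivity) (sq_nonneg _) : 0 ≤ cL / 3 * oneArmProb d p n ^ 2)
        linarith [h]
      linarith
    have hle : t * μ.real (⋃ x ∈ S, F n x) ≤ ∑ x ∈ S, μ.real (F n x) := by
      have : 0 ≤ cL / 6 * (2 * (n : ℝ) + 1) ^ d * oneArmProb d p n ^ 2 := mul_nonneg (by positivity) (sq_nonneg _)
      linarith
    -- Paley–Zygmund and the second moment
    have hPZ := sq_sub_le_real_gt_card_mul_sum μ S (fun x => F n x) (fun x _ => hFm n x) ht0 hle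
    have hM2 := sum_sum_real_openConn_inter_le_of_ratio hd p hA hB.le hR1 hR2 hπ1 hn4'
    rw [← hμ, ← hm, ← hS] at hM2
    have hM2' : ∑ x ∈ S, ∑ y ∈ S, μ.real (F n x ∩ F n y) ≤ C₃ * (2 * (n : ℝ) + 1) ^ (2 * d) * oneArmProb d p n ^ 3 := by
      have hnd : (n : ℝ) ^ d ≤ (2 * (n : ℝ) + 1) ^ d := pow_le_pow_left₀ hn0.le (by linarith) d
      calc ∑ x ∈ S, ∑ y ∈ S, μ.real (F n x ∩ F n y)
          ≤ ∑ x ∈ S, ∑ y ∈ S, μ.real (openConn 0 x ∩ openConn 0 y) :=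
            Finset.sum_le_sum fun x _ => Finset.sum_le_sum fun y _ =>
              measureReal_mono (Set.inter_subset_inter (hFsub n x) (hFsub n y)) (measure_ne_top _ _)
        _ ≤ C₃ * (2 * (n : ℝ) + 1) ^ d * (n : ℝ) ^ d * oneArmProb d p n ^ 3 := by rw [hC₃, hC₂]; exact hM2
        _ ≤ C₃ * (2 * (n : ℝ) + 1) ^ d * (2 * (n : ℝ) + 1) ^ d * oneArmProb d p n ^ 3 :=
            mul_le_mul_of_nonneg_right (mul_le_mul_of_nonneg_left hnd (by positivity)) (pow_nonneg hπn0 3)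
        _ = C₃ * (2 * (n : ℝ) + 1) ^ (2 * d) * oneArmProb d p n ^ 3 := by ring
    -- the key inequality `(cL/6)² V² π⁴ ≤ μ(E) · C₃ V² π³`
    set E : Set (BondConfig (Site d)) := {ω | t < ((S.filter (fun x => ω ∈ F n x)).card : ℝ)} with hE
    have hkey : (cL / 6 * (2 * (n : ℝ) + 1) ^ d * oneArmProb d p n ^ 2) ^ 2 ≤
        μ.real E * (C₃ * (2 * (n : ℝ) + 1) ^ (2 * d) * oneArmProb d p n ^ 3) :=
      calc (cL / 6 * (2 * (n : ℝ) + 1) ^ d * oneArmProb d p n ^ 2) ^ 2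
          ≤ (∑ x ∈ S, μ.real (F n x) - t * μ.real (⋃ x ∈ S, F n x)) ^ 2 :=
            pow_le_pow_left₀ (mul_nonneg (by positivity) (sq_nonneg _)) hgap 2
        _ ≤ μ.real E * ∑ x ∈ S, ∑ y ∈ S, μ.real (F n x ∩ F n y) := hPZ
        _ ≤ μ.real E * (C₃ * (2 * (n : ℝ) + 1) ^ (2 * d) * oneArmProb d p n ^ 3) := mul_le_mul_of_nonneg_left hM2' measureReal_nonneg
    -- divide
    have hEge : cL ^ 2 / (36 * C₃) * oneArmProb d p n ≤ μ.real E := by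
      rcases hπn0.eq_or_lt with hπ0 | hπpos
      · rw [← hπ0, mul_zero]; exact measureReal_nonneg
      · have hV : 0 < (2 * (n : ℝ) + 1) ^ (2 * d) := by positivity
        have hX : 0 < C₃ * (2 * (n : ℝ) + 1) ^ (2 * d) * oneArmProb d p n ^ 3 := mul_pos (mul_pos hC₃pos hV) (pow_pos hπpos 3)
        have hkey' := (div_le_iff₀ hX).2 hkey
        refine le_trans (le_of_eq ?_) hkey'
        field_simp
        ring
    -- `E ⊆ target ∩ arm`
    have hEsub : μ.real E ≤ μ.real
        ({ω | min (cL / (6 * B)) ((2 * (N₁ : ℝ) + 1) ^ d)⁻¹ * ((2 * (n : ℝ) + 1) ^ d * oneArmProb d p n) ≤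
            ((((box d n).filter fun z => ω ∈ F n z).card : ℕ) : ℝ)} ∩ siteToBoundary d (n / 2)) := by
      refine DCT16.real_mono_of_forall_subset_edgeSet (zdGraph d) p fun ω hω h => ?_
      rw [hE, Set.mem_setOf_eq] at h
      have hcard : ((S.filter (fun x => ω ∈ F n x)).card : ℝ) ≤ ((((box d n).filter fun z => ω ∈ F n z).card : ℕ) : ℝ) := by
        exact_mod_cast Finset.card_le_card (Finset.filter_subset_filter _ Finset.sdiff_subset)
      refine ⟨?_, ?_⟩
      · rw [Set.mem_setOf_eq]
        have hlam : min (cL / (6 * B)) ((2 * (N₁ : ℝ) + 1) ^ d)⁻¹ * ((2 * (n : ℝ) + 1) ^ d * oneArmProb d p n) ≤ t :=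
          mul_le_mul_of_nonneg_right (min_le_left _ _) (mul_nonneg (by positivity) hπn0)
        linarith
      · -- some `x ∈ S` has `ω ∈ F n x ⊆ {0 ↔ x}`
        have hpos : 0 < (S.filter (fun x => ω ∈ F n x)).card := by
          have : (0 : ℝ) < ((S.filter (fun x => ω ∈ F n x)).card : ℝ) := ht0.trans_lt h
          exact_mod_cast this
        obtain ⟨x, hx⟩ := Finset.card_pos.1 hpos
        rw [Finset.mem_filter, hS, Finset.mem_sdiff] at hx
        rw [← hm, ← DCT16.armEvent_zero]
        exact DCT16.armEvent_of_pathIn hω (pathIn_univ_of_reachable_zd (hFsub n x hx.2))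
          (Or.inl (by rw [sub_zero]; exact hx.1.2))
    calc min (cL ^ 2 / (36 * C₃)) 1 * oneArmProb d p n ≤ cL ^ 2 / (36 * C₃) * oneArmProb d p n :=
          mul_le_mul_of_nonneg_right (min_le_left _ _) hπn0
      _ ≤ μ.real E := hEge
      _ ≤ _ := hEsub

open Classical in
/-- **FAT CLUSTERS AT THE IIC SCALE** (every `p`, `d ≥ 1`): assume the ratio inequalities (R1), (R2), `π_p(1) > 0`, and the
two-point lower bound `cL · π_p(n)² ≤ τ_p(0, x)` for `x ∈ Λ(n) ∖ {0}`.  Then there are `λ, c > 0` with, for every `n ≥ 1`,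
`c · π_p(n) ≤ P_p( λ·(2n+1)^d·π_p(n) ≤ #{z ∈ Λ(n) : 0 ↔ z}  and  0 ↔ ∂ⁱⁿΛ(⌊n/2⌋) )` — with probability comparable to the one-arm
probability the cluster of the origin fills a positive fraction `λ π(n)` of `Λ(n)`, the volume `n^d π(n)` of the incipient infinite
cluster (`exists_le_real_card_ge_of_ratio` with `F n x = {0 ↔ x}`). [cite: BorgsChayesKestenSpencer1999, §1 (hyperscaling relations)] [cite: Kesten1986, Thm. (8)] -/
theorem exists_le_real_volume_ge_of_ratio (hd : 1 ≤ d) (p : unitInterval) {A B cL : ℝ} (hA : 0 ≤ A) (hB : 0 < B)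
    (hcL : 0 < cL)
    (hR1 : ∀ j n : ℕ, 1 ≤ j → j ≤ n →
      oneArmProb d p j ^ 2 * ((j : ℝ) / (16 * n)) ^ (d - 1) ≤ A * oneArmProb d p n ^ 2)
    (hR2 : ∀ j n : ℕ, 1 ≤ j → j ≤ n → n ≤ 8 * j → oneArmProb d p j ≤ B * oneArmProb d p n)
    (hπ1 : 0 < oneArmProb d p 1)
    (hL : ∀ (n : ℕ) (x : Site d), x ∈ box d n → x ≠ 0 → cL * oneArmProb d p n ^ 2 ≤ tau d p 0 x) :
    ∃ lam c : ℝ, 0 < lam ∧ 0 < c ∧ ∀ n : ℕ, 1 ≤ n →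
      c * oneArmProb d p n ≤ (bondPercolation (zdGraph d) p).real
        ({ω | lam * ((2 * (n : ℝ) + 1) ^ d * oneArmProb d p n) ≤
            ((((box d n).filter fun z => ω ∈ (openConn (0 : Site d) z : Set (BondConfig (Site d)))).card : ℕ) : ℝ)} ∩
          siteToBoundary d (n / 2)) :=
  exists_le_real_card_ge_of_ratio hd p hA hB hcL hR1 hR2 hπ1 (fun _ x => (openConn (0 : Site d) x : Set (BondConfig (Site d))))
    (fun _ _ => subset_rfl) (fun _ x => measurableSet_openConn_holds (0 : Site d) x) (fun _ _ => SimpleGraph.Reachable.refl _)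
    (n₀ := 0) (fun n x hx _ hx0 => by rw [← tau_def]; exact hL n x hx hx0)

/-! ## The upper tail of the volume (every `p > 0` satisfying (R1)) -/

open Classical in
/-- **Volume upper tail** (every `p > 0` satisfying (R1); `d ≥ 1`): for `λ > 0`, `n ≥ 1` and every `R`,
`P_p( λ·(2n+1)^d·π_p(n) ≤ #{z ∈ Λ(R) : 0 ↔ z} ) ≤ (1 + C₂/λ) · π_p(n)`: either `0 ↔ ∂ⁱⁿΛ(n)` (probability `π(n)`), or the whole
cluster sits inside `Λ(n)` and Markov's inequality with `E|C(0) ∩ Λ(n)| ≤ C₂ n^d π(n)²` (`sum_tau_le_of_ratio`) applies.  Uniform in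
`R`, i.e. a bound for `P_p(|C(0)| ≥ λ (2n+1)^d π_p(n))`. [cite: BorgsChayesKestenSpencer1999, §1 (hyperscaling relations)] -/
theorem real_volume_ge_le_of_ratio (hd : 1 ≤ d) (p : unitInterval) (hp : 0 < (p : ℝ)) {A : ℝ} (hA : 0 ≤ A)
    (hR1 : ∀ j n : ℕ, 1 ≤ j → j ≤ n →
      oneArmProb d p j ^ 2 * ((j : ℝ) / (16 * n)) ^ (d - 1) ≤ A * oneArmProb d p n ^ 2)
    {lam : ℝ} (hlam : 0 < lam) {n : ℕ} (hn : 1 ≤ n) (R : ℕ) :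
    (bondPercolation (zdGraph d) p).real
        {ω | lam * ((2 * (n : ℝ) + 1) ^ d * oneArmProb d p n) ≤
          ((((box d R).filter fun z => ω ∈ (openConn (0 : Site d) z : Set (BondConfig (Site d)))).card : ℕ) : ℝ)} ≤
      (1 + (2 * d * A * (192 : ℝ) ^ (d - 1) + (5 : ℝ) ^ d * (A * (16 : ℝ) ^ (d - 1) / oneArmProb d p 1 ^ 2)) / lam) *
        oneArmProb d p n := by
  classical
  set μ := bondPercolation (zdGraph d) p with hμ
  set C₂ : ℝ := 2 * d * A * (192 : ℝ) ^ (d - 1) + (5 : ℝ) ^ d * (A * (16 : ℝ) ^ (d - 1) / oneArmProb d p 1 ^ 2) with hC₂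
  have hπpos : ∀ k : ℕ, 0 < oneArmProb d p k := fun k =>
    (pow_pos hp k).trans_le (DKT20.pow_le_real_siteToBoundary hd p k)
  have hπ1 := hπpos 1
  have hπn := hπpos n
  have hn0 : (0 : ℝ) < n := by exact_mod_cast hn
  set t : ℝ := lam * ((2 * (n : ℝ) + 1) ^ d * oneArmProb d p n) with ht
  have htpos : 0 < t := mul_pos hlam (mul_pos (by positivity) hπn)
  -- split according to the arm event
  have hsplit : μ.real {ω | t ≤ ((((box d R).filter fun z => ω ∈ (openConn (0 : Site d) z : Set (BondConfig (Site d)))).card : ℕ) : ℝ)} ≤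
      μ.real (siteToBoundary d n ∪
        {ω | t ≤ ((((box d n).filter fun z => ω ∈ (openConn (0 : Site d) z : Set (BondConfig (Site d)))).card : ℕ) : ℝ)}) := by
    refine DCT16.real_mono_of_forall_subset_edgeSet (zdGraph d) p fun ω hω h => ?_
    rw [Set.mem_setOf_eq] at h
    by_cases harm : ω ∈ siteToBoundary d n
    · exact Or.inl harm
    · refine Or.inr ?_
      rw [Set.mem_setOf_eq]
      refine h.trans ?_
      have hsub : ((box d R).filter fun z => ω ∈ (openConn (0 : Site d) z : Set (BondConfig (Site d)))) ⊆
          ((box d n).filter fun z => ω ∈ (openConn (0 : Site d) z : Set (BondConfig (Site d)))) := by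
        intro z hz
        rw [Finset.mem_filter] at hz ⊢
        refine ⟨?_, hz.2⟩
        by_contra hzn
        apply harm
        rw [← DCT16.armEvent_zero]
        exact DCT16.armEvent_of_pathIn hω (pathIn_univ_of_reachable_zd hz.2) (Or.inl (by rw [sub_zero]; exact hzn))
      exact_mod_cast Finset.card_le_card hsub
  have hMarkov := real_card_filter_openConn_ge_le_sum_div μ n htpos
  have hsum : ∑ z ∈ box d n, μ.real (openConn (0 : Site d) z) ≤ C₂ * (n : ℝ) ^ d * oneArmProb d p n ^ 2 := by
    have h := sum_tau_le_of_ratio hd p hA hR1 hπ1 hn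
    rw [hC₂]
    refine le_trans (le_of_eq (Finset.sum_congr rfl fun z _ => ?_)) h
    rw [hμ, tau_def]
  have hnd : (n : ℝ) ^ d ≤ (2 * (n : ℝ) + 1) ^ d := pow_le_pow_left₀ hn0.le (by linarith) d
  calc μ.real {ω | t ≤ ((((box d R).filter fun z => ω ∈ (openConn (0 : Site d) z : Set (BondConfig (Site d)))).card : ℕ) : ℝ)}
      ≤ μ.real (siteToBoundary d n) +
          μ.real {ω | t ≤ ((((box d n).filter fun z => ω ∈ (openConn (0 : Site d) z : Set (BondConfig (Site d)))).card : ℕ) : ℝ)} :=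
        hsplit.trans (measureReal_union_le _ _)
    _ ≤ oneArmProb d p n + C₂ * (n : ℝ) ^ d * oneArmProb d p n ^ 2 / t :=
        add_le_add le_rfl (hMarkov.trans (div_le_div_of_nonneg_right hsum htpos.le))
    _ ≤ oneArmProb d p n + C₂ * (2 * (n : ℝ) + 1) ^ d * oneArmProb d p n ^ 2 / t := by
        have hC : 0 ≤ C₂ :=
          add_nonneg (by positivity) (mul_nonneg (by positivity) (div_nonneg (by positivity) (sq_nonneg _)))
        have := mul_le_mul_of_nonneg_left hnd hC
        have h2 : C₂ * (n : ℝ) ^ d * oneArmProb d p n ^ 2 ≤ C₂ * (2 * (n : ℝ) + 1) ^ d * oneArmProb d p n ^ 2 :=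
          mul_le_mul_of_nonneg_right this (sq_nonneg _)
        linarith [div_le_div_of_nonneg_right h2 htpos.le]
    _ = (1 + C₂ / lam) * oneArmProb d p n := by
        rw [ht]; field_simp

end Rsw3

end Summit.CriticalPhenomena.PercolationContinuityZ3.Theorems
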